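/-
Copyright: lit-balaban Phase-2 proof seat p27 (gen 38).  Statement-level skeleton of a published paper; no proof claims beyond what the
kernel checks below.
-/
import Literature.MathematicalPhysics.QuantumFieldTheory.BalabanImbrieJaffe1984to88.BIJ88Loc231RegionOfInputs
import Literature.MathematicalPhysics.QuantumFieldTheory.BalabanImbrieJaffe1984to88.BIJ88LocDerivHolder231RegularTorus

/-!
# `BalabanImbrieJaffe1984to88.BIJ88LocDeriv231RegionOfInputsLipschitz` — T. Bałaban, J. Imbrie, A. Jaffe, *Effective action and cluster
properties of the abelian Higgs model*, Commun. Math. Phys. **114** (1988) 257–315 [BalabanImbrieJaffe1988], Sect. 2 p. 263 [PDF 7], (2.31)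
and the sentence after (2.33): **THE COVARIANT-DERIVATIVE MEMBER OF (2.31) FOR A GENERAL REGION `Ω ⊇ Ω₀`, THE PRINTED CUBES AND WEIGHTS OF
RECORD AND A GENERIC LIPSCHITZ CUT-OFF `ζ″`, AT AN ARBITRARY `U(1)` FIELD `u`, FROM THE FOUR [6]-INPUTS AS HYPOTHESES** — p29 gen 30's
`BIJ88Loc231RegionOfInputs.deriv231_region_of_inputs` with p13's Lipschitz cut-off `cutoff R₁ R₀ |·|_T` replaced by an arbitrary real
cut-off with the printed properties (`|ζ″| ≤ 1`, `= 0` beyond `R₀`, `= 1` within `R₁`, one-step modulus `≤ K₁/(R₀ − R₁)`), so that the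
smooth cut-offs of (2.29) (r18's `ζ^Π`) are covered.  This is the far-pair input of this seat's order-`(1 + θ)` Hölder member of (2.31) in
hypothesis form (`BIJ88LocDerivHolder231RegionOfInputs`, filed next), and by itself the generic-cut-off row of the `D` column of r18's
p. 263 coverage matrix (C2S14-CLOSURE §6) in hypothesis form.

statement-level skeleton of published theorems with citation tags; proofs where landed; nothing here is a claim about the Yang–Mills mass gap

PDF held: `paper:balaban1988-cmp114-bij-abelian-higgs-effective-action` (journal page = PDF page + 256); p. 263 [PDF 7] re-read this session
(render `run/shared/lean/pub/lit-balaban/lit-balaban-p31/renders/original-p007-x2.png`); [6] = [Balaban1983RegularityDecay] Theorem p. 573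
(1.10)–(1.12).

CITATION HEADER (lean-in-tree rule).  Part of the lit-balaban TYPED SKELETON (HOME `run/shared/lean/pub/lit-balaban/`), PHASE-2 proof seat
p27 gen 38 (unit `lit-balaban-p27-g38`; TAKING #1 line HOME/STATUS.md 2026-08-23T09:15:21Z, free-target protocol G.5-34(d); window closed
09:37Z — p29 g30 «NO OBJECTION — it is yours» 09:16:28Z, r18 g25 «NO OBJECTION — WELCOME» 09:17:44Z, C2S14-CLOSURE v1.17b marks the
H1θ-at-small-u cell TAKEN by p27 g38).  Rows **C2.Eq2.31** / **C2.Claim@263** (owner r18; heads unchanged — LOCATED, HYPOTHESIS-FORM member).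
Kind: theorems only (no definition, no `Prop`-valued fact).  USED BY NAME, nothing restated: p29 g26–30 `BIJ88LocWeights227Torus` (`cubeFam`,
`lamFam`, `labels`, `activeLabels`, `rowHyp_i`, `mem_activeLabels_of_ne_zero_of_deep`, `card_subtype_activeLabels_le`, `cubeFam_fits`,
`cubeOf_subset`, `sum_abs_lamT_le_one`), `BIJ88Close231WholeTorusFlatCwt` (r18: `rowHyp_ii_torus`, `lt_T_of_not_mem`),
`BIJ88LocDeriv231FlatTorus` (`covD_gLocT_sub_apply`), `BIJ88LocDeriv230FlatTorus` (`T_shift_le_one`, `abs_T_shift_sub_le`),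
`BIJ88LocDeriv230ZetaPiFlatTorus` (`norm_rowSource_sub_le_of_lipschitz`), `BIJ88NeumannPropagatorFlatClose231` (`norm_rowSource_le`,
`rowSource_ne_zero`, `abs_lam_le_one`), r18 g25 `BIJ88LocDerivHolder231RegularTorus` v1.2 §1 (`norm_tail_le'`, `norm_tailDiff_le'`,
`T_gt_of_tail_ne_zero'`, `T_gt_of_tailDiff_ne_zero'`), p31's `gBox` / `gLocT` / `cubeT` / `boxCoord`, p38's `B5Ineq137Torus.T`, r18's
`BIJ88Sect3Statements.covD` / `cfg`.

THE PRINTED TEXT (p. 263, verbatim).  *"|(G_{k,loc}(u)f − G_k(Ω,u)f)(x)| ≦ e^{−cr(e_k)}e^{−c dist(suppt f,x)}‖f‖_∞, (2.31) for dist(x, Ω^c) ≧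
O(r(e_k)). … We assume that u is smooth in the □_α's entering the sum in (2.27); for (2.31) we assume smoothness throughout the subset
Ω ⊂ T_η. … Bounds analogous to (2.30), (2.31) hold for covariant derivatives and Hölder derivatives of G_{k,loc}(u) of order less than
two."*; (2.29): *"ζ″(x₁, x₂) = 0 for |x₁ − x₂| ≧ 2r(e_k), = 1 for |x₁ − x₂| ≦ r(e_k)"*.

WHAT IS PROVED (theorems only; 0 `sorry`; standard axioms).
* §1 **`deriv231_region_of_inputs_of_lipschitz`** — for `0 ≤ c₀`, `0 ≤ K₁`: `∃ C > 0` (on `d, c₀, K₁`) such that for every torus of the series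
  (`P.d = d+1`), every `a`, `1 ≤ k ≤ K`, every `U(1)` field `u`, every finite region `Ω`, all rates `δ₀ > 0`, depths `ρ ≥ 0`, GIVEN (H1)–(H4)
  exactly as in p29's `deriv231_region_of_inputs` ((1.11)–(1.12) `D_u`/value closeness for the fitting cubes `□ ⊆ Ω` at their `ρ`-deep rows,
  (1.10) `D_u`/value members of `G_k(Ω,u)` at the `ρ`-deep rows of `Ω`, all at `(c₀, δ₀)`), for the reference box `Ω₀ ⊆ Ω`, `s ≥ 1`,
  `R > ρ + 1`, `0 ≤ R₁ < R₀`, `W ≥ 2s/3 + R₀/2 + R`, torus gap `≥ R`, EVERY real `ζ″` with the four printed properties, every bond with both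
  ends in `Ω₀` at chart depth `≥ R₀ + R`, every `f` (`‖f‖_∞ ≤ F`) supported at distance `≥ D ≥ 0` from `x`:
  `‖D_u(G_{k,loc}(u)f)(x,μ) − D_u(G_k(Ω,u)f)(x,μ)‖ ≤ (L^kε)·C·[m(1 + L^k((R₀−R₁)⁻¹ + s⁻¹))e^{−δ₀(2R−1)/L^k} + (1 + L^k(R₀−R₁)⁻¹)e^{−(δ₀/2)(R₁−1)/L^k}]·e^{−(δ₀/2)D/L^k}·F`,
  `m = (⌊(L^k − 1 + R₀)/s⌋ + 3)^{d+1}`.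
* §2 **`deriv231_region_of_inputs_zetaPi`** — §1 at r18's smooth product cut-off `ζ″ = zetaPi R₁ R₀ 0` (`1 ≤ R₁ < R₀ ≤ (|T^{(0)}| − 3)/2`),
  hypothesis-free in the cut-off (`K₁ = C_σ` from the universal profile bound).
HONEST SCOPE / DIVERGENCE.  (i) HYPOTHESIS FORM exactly as p29's file (providers of record at small plaquette fields: p29's
`inputs_smallPlaquette_region` / `_deriv`, built on p30 g29 / p34; regular `u`: r18/r01; flat: r18/p31); no instance in this file beyond §2's
specialisation of the cut-off.  (ii) The region enters only through the comparison propagator and the inputs; the data live in `Ω₀ ⊆ Ω`.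
(iii) Deep bonds only (chart depth `≥ R₀ + R`).  (iv) Constants as in p29's file with `K₁` for p13's universal Lipschitz constant; not
optimized.  `set_option maxHeartbeats 400000` on §1 (long statement; p29's budget).  Imports: p29 g30 `BIJ88Loc231RegionOfInputs`, r18 g25
`BIJ88LocDerivHolder231RegularTorus` (v1.2; for the four generic tail kernels).  Literature + Mathlib only.  Unit `lit-balaban-p27`
(literature-prover-lit-balaban-p27-g38-0), HOME `run/shared/lean/pub/lit-balaban/`, 2026-08-23.  NOT summit progress.
-/

open scoped BigOperators Matrix ComplexConjugate
open Finset Matrix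

namespace Literature.MathematicalPhysics.QuantumFieldTheory.BalabanImbrieJaffe1984to88.BIJ88LocDeriv231RegionOfInputsLipschitz

open Literature.MathematicalPhysics.QuantumFieldTheory.Balaban1983to89
open BIJ88Sect3Statements (U1 toC cfg covD norm_toC)
open BIJ85BlockAveragesTorus BIJ85BlockAveragesTorusK
open BIJ88NeumannPropagator227Torus (gBox)
open BIJ88DeltaLoc234Torus (gLocT)
open BIJ88NeumannPropagatorFlatDecayCube (cubeT boxCoord)
open BIJ88LocWeights227Torus
open BIJ88Close231WholeTorusFlatCwt (rowHyp_ii_torus lt_T_of_not_mem)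
open BIJ88NeumannPropagatorFlatClose231 (norm_rowSource_le rowSource_ne_zero abs_lam_le_one)
open BIJ88LocDeriv230FlatTorus (T_shift_le_one abs_T_shift_sub_le)
open BIJ88LocDeriv230ZetaPiFlatTorus (norm_rowSource_sub_le_of_lipschitz)
open BIJ88LocDeriv231FlatTorus (covD_gLocT_sub_apply)
open BIJ88LocDerivHolder231RegularTorus (norm_tail_le' norm_tailDiff_le' T_gt_of_tail_ne_zero' T_gt_of_tailDiff_ne_zero')

noncomputable section

variable {d : ℕ} {P : Params}

/-- kernel: a deeper chart margin implies a shallower one. [folklore] -/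
private theorem depth_mono (hPd : P.d = d + 1) {n : ℕ} {c M0 : Fin (d + 1) → ℕ} {D D' : ℝ} (hDD : D ≤ D') {x : Balaban1983to89.Site P 0}
    (hdeep : ∀ i, D' ≤ (boxCoord hPd n c x i : ℝ) ∧ (boxCoord hPd n c x i : ℝ) + D' ≤ (n * M0 i : ℕ) - 1) :
    ∀ i, D ≤ (boxCoord hPd n c x i : ℝ) ∧ (boxCoord hPd n c x i : ℝ) + D ≤ (n * M0 i : ℕ) - 1 :=
  fun i => ⟨hDD.trans (hdeep i).1, by linarith [(hdeep i).2]⟩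

/-- kernel: `e^{−δ'E} ≤ e^{−δE}` for `δ ≤ δ'`, `E ≥ 0`. [folklore] -/
private theorem exp_le_exp_of_rate {δ δ' E : ℝ} (hδ : δ ≤ δ') (hE : 0 ≤ E) : Real.exp (-(δ' * E)) ≤ Real.exp (-(δ * E)) :=
  Real.exp_le_exp.2 (neg_le_neg (mul_le_mul_of_nonneg_right hδ hE))

/-! ## §1 The covariant-derivative analogue of (2.31) for a general region `Ω ⊇ Ω₀` and a generic Lipschitz cut-off -/

set_option maxHeartbeats 400000 in
/-- **THE COVARIANT-DERIVATIVE ANALOGUE OF (2.31) FOR A GENERAL REGION `Ω ⊇ Ω₀`, PRINTED CUBES AND WEIGHTS, A GENERIC LIPSCHITZ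
CUT-OFF, ARBITRARY `U(1)` FIELD, FROM THE FOUR [6]-INPUTS AS HYPOTHESES** (p. 263: *"|(G_{k,loc}(u)f − G_k(Ω,u)f)(x)| ≦ … (2.31) for
dist(x, Ω^c) ≧ O(r(e_k)) … for (2.31) we assume smoothness throughout the subset Ω ⊂ T_η … Bounds analogous to (2.30), (2.31) hold for
covariant derivatives …"*).  p29 gen 30's `BIJ88Loc231RegionOfInputs.deriv231_region_of_inputs` VERBATIM — same hypotheses (H1)–(H4),
same data, same conclusion and constants — with p13's Lipschitz cut-off `cutoff R₁ R₀ |·|_T` replaced by an ARBITRARY real cut-off `ζ″`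
subject to `|ζ″| ≤ 1`, `ζ″(x,y) = 0` for `|x − y|_T ≥ R₀`, `ζ″(x,y) = 1` for `|x − y|_T ≤ R₁` and the one-step modulus
`|ζ″(x+e_ν,y) − ζ″(x,y)| ≤ K₁/(R₀ − R₁)` (the constant `C` now depends on `(d, c₀, K₁)`); in particular it covers the SMOOTH cut-offs
(r18's `ζ^Π`) that the Hölder member of order `1 + θ` needs.  Mechanism unchanged: p29 g27's bond identity `covD_gLocT_sub_apply`, TERM 1 ←
(H1), TERM 2 ← (H2) on the bond-difference sources (`norm_rowSource_sub_le_of_lipschitz`), TERMS 3–4 ← (H3)/(H4) on the tails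
`(ζ″(x+e_μ,·) − 1)f`, `(ζ″(x+e_μ,·) − ζ″(x,·))f`, which live at torus distance `> R₁ − 1` from `x` (r18's `T_gt_of_tail_ne_zero'`,
`T_gt_of_tailDiff_ne_zero'`, `norm_tail_le'`, `norm_tailDiff_le'`).
[cite: BalabanImbrieJaffe1988, (2.31) p.263] [cite: Balaban1983RegularityDecay, Theorem p.573 (1.10)–(1.12)] -/
theorem deriv231_region_of_inputs_of_lipschitz (d : ℕ) {c₀ : ℝ} (hc₀ : 0 ≤ c₀) {K₁ : ℝ} (hK₁ : 0 ≤ K₁) :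
    ∃ C : ℝ, 0 < C ∧ ∀ (P : Params) (hPd : P.d = d + 1) (a : ℝ) (k : ℕ), 1 ≤ k → k ≤ P.K →
      ∀ (U : GaugeField P 0 U1) (Ω : Finset (Balaban1983to89.Site P 0)) (δ₀ ρ : ℝ), 0 < δ₀ → 0 ≤ ρ →
      -- (H1) the (1.11)–(1.12) covariant-derivative closeness member for the fitting no-wrap cubes `□ ⊆ Ω`
      (∀ (c' M' : Fin (d + 1) → ℕ), (∀ i, 1 ≤ M' i) → (∀ i, c' i * P.L ^ k + P.L ^ k * M' i ≤ P.sitesPerDir 0) →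
          (∀ i, P.L ^ k * M' i < P.sitesPerDir 0) → (cubeT hPd (P.L ^ k) c' fun i => P.L ^ k * M' i) ⊆ Ω →
        ∀ (x : Balaban1983to89.Site P 0) (μ : Fin P.d), x ∈ (cubeT hPd (P.L ^ k) c' fun i => P.L ^ k * M' i) →
          x.shift μ ∈ (cubeT hPd (P.L ^ k) c' fun i => P.L ^ k * M' i) →
          (∀ w, w ∉ (cubeT hPd (P.L ^ k) c' fun i => P.L ^ k * M' i) → ρ ≤ B5Ineq137Torus.T P 0 x w) →
        ∀ (g : Balaban1983to89.Site P 0 → ℂ) (F D Db Df : ℝ), (∀ y, ‖g y‖ ≤ F) →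
          (∀ y, y ∉ (cubeT hPd (P.L ^ k) c' fun i => P.L ^ k * M' i) → g y = 0) →
          0 ≤ D → (∀ y, g y ≠ 0 → D ≤ B5Ineq137Torus.T P 0 x y) →
          0 ≤ Db → (∀ w, w ∉ (cubeT hPd (P.L ^ k) c' fun i => P.L ^ k * M' i) → Db ≤ B5Ineq137Torus.T P 0 x w) →
          0 ≤ Df → (∀ y, g y ≠ 0 → ∀ w, w ∉ (cubeT hPd (P.L ^ k) c' fun i => P.L ^ k * M' i) → Df ≤ B5Ineq137Torus.T P 0 y w) →
          ‖covD P.eps⁻¹ (cfg U) (gBox (B1RG242Torus.α P a k * (P.L : ℝ) ^ (k * P.d)) P.eps⁻¹ U k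
                  (cubeT hPd (P.L ^ k) c' fun i => P.L ^ k * M' i) *ᵥ g) ⟨x, μ⟩ -
              covD P.eps⁻¹ (cfg U) (gBox (B1RG242Torus.α P a k * (P.L : ℝ) ^ (k * P.d)) P.eps⁻¹ U k Ω *ᵥ g) ⟨x, μ⟩‖ ≤
            P.spacing k * (c₀ * Real.exp (-(δ₀ * (((P.L : ℝ) ^ k)⁻¹ * D))) * Real.exp (-(δ₀ * (((P.L : ℝ) ^ k)⁻¹ * (Db + Df)))) * F)) →
      -- (H2) the (1.11)–(1.12) value closeness member for the same cubes and rows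
      (∀ (c' M' : Fin (d + 1) → ℕ), (∀ i, 1 ≤ M' i) → (∀ i, c' i * P.L ^ k + P.L ^ k * M' i ≤ P.sitesPerDir 0) →
          (∀ i, P.L ^ k * M' i < P.sitesPerDir 0) → (cubeT hPd (P.L ^ k) c' fun i => P.L ^ k * M' i) ⊆ Ω →
        ∀ (x : Balaban1983to89.Site P 0), x ∈ (cubeT hPd (P.L ^ k) c' fun i => P.L ^ k * M' i) →
          (∀ w, w ∉ (cubeT hPd (P.L ^ k) c' fun i => P.L ^ k * M' i) → ρ ≤ B5Ineq137Torus.T P 0 x w) →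
        ∀ (g : Balaban1983to89.Site P 0 → ℂ) (F D Db Df : ℝ), (∀ y, ‖g y‖ ≤ F) →
          (∀ y, y ∉ (cubeT hPd (P.L ^ k) c' fun i => P.L ^ k * M' i) → g y = 0) →
          0 ≤ D → (∀ y, g y ≠ 0 → D ≤ B5Ineq137Torus.T P 0 x y) →
          0 ≤ Db → (∀ w, w ∉ (cubeT hPd (P.L ^ k) c' fun i => P.L ^ k * M' i) → Db ≤ B5Ineq137Torus.T P 0 x w) →
          0 ≤ Df → (∀ y, g y ≠ 0 → ∀ w, w ∉ (cubeT hPd (P.L ^ k) c' fun i => P.L ^ k * M' i) → Df ≤ B5Ineq137Torus.T P 0 y w) →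
          ‖(gBox (B1RG242Torus.α P a k * (P.L : ℝ) ^ (k * P.d)) P.eps⁻¹ U k (cubeT hPd (P.L ^ k) c' fun i => P.L ^ k * M' i) *ᵥ g) x -
              (gBox (B1RG242Torus.α P a k * (P.L : ℝ) ^ (k * P.d)) P.eps⁻¹ U k Ω *ᵥ g) x‖ ≤
            P.spacing k ^ 2 * (c₀ * Real.exp (-(δ₀ * (((P.L : ℝ) ^ k)⁻¹ * D))) * Real.exp (-(δ₀ * (((P.L : ℝ) ^ k)⁻¹ * (Db + Df)))) * F)) →
      -- (H3) the (1.10) covariant-derivative member of `G_k(Ω,u)` at the `ρ`-deep rows of `Ω`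
      (∀ (x : Balaban1983to89.Site P 0), x ∈ Ω → (∀ w, w ∉ Ω → ρ ≤ B5Ineq137Torus.T P 0 x w) →
        ∀ (μ : Fin P.d) (g : Balaban1983to89.Site P 0 → ℂ) (F D : ℝ), (∀ y, ‖g y‖ ≤ F) → 0 ≤ D →
          (∀ y, g y ≠ 0 → D ≤ B5Ineq137Torus.T P 0 x y) →
          ‖covD P.eps⁻¹ (cfg U) (gBox (B1RG242Torus.α P a k * (P.L : ℝ) ^ (k * P.d)) P.eps⁻¹ U k Ω *ᵥ g) ⟨x, μ⟩‖ ≤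
            P.spacing k * (c₀ * Real.exp (-(δ₀ * (((P.L : ℝ) ^ k)⁻¹ * D))) * F)) →
      -- (H4) the (1.10) value member of `G_k(Ω,u)` at the `ρ`-deep rows of `Ω`
      (∀ (x : Balaban1983to89.Site P 0), x ∈ Ω → (∀ w, w ∉ Ω → ρ ≤ B5Ineq137Torus.T P 0 x w) →
        ∀ (g : Balaban1983to89.Site P 0 → ℂ) (F D : ℝ), (∀ y, ‖g y‖ ≤ F) → 0 ≤ D →
          (∀ y, g y ≠ 0 → D ≤ B5Ineq137Torus.T P 0 x y) →
          ‖(gBox (B1RG242Torus.α P a k * (P.L : ℝ) ^ (k * P.d)) P.eps⁻¹ U k Ω *ᵥ g) x‖ ≤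
            P.spacing k ^ 2 * (c₀ * Real.exp (-(δ₀ * (((P.L : ℝ) ^ k)⁻¹ * D))) * F)) →
      ∀ (c M0 : Fin (d + 1) → ℕ), (∀ i, 1 ≤ M0 i) →
        (∀ i, c i * P.L ^ k + P.L ^ k * M0 i ≤ P.sitesPerDir 0) → (∀ i, P.L ^ k * M0 i < P.sitesPerDir 0) →
        (cubeT hPd (P.L ^ k) c fun i => P.L ^ k * M0 i) ⊆ Ω →
      ∀ (s W : ℕ), 1 ≤ s → ∀ (R R₀ R₁ : ℝ), ρ + 1 < R → 0 ≤ R₁ → R₁ < R₀ → 2 * (s : ℝ) / 3 + R₀ / 2 + R ≤ W →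
        (∀ i, ((P.L ^ k * M0 i : ℕ) : ℝ) + R ≤ P.sitesPerDir 0) →
      ∀ (ζ : Balaban1983to89.Site P 0 → Balaban1983to89.Site P 0 → ℝ), (∀ x y, |ζ x y| ≤ 1) →
        (∀ x y, R₀ ≤ B5Ineq137Torus.T P 0 x y → ζ x y = 0) → (∀ x y, B5Ineq137Torus.T P 0 x y ≤ R₁ → ζ x y = 1) →
        (∀ (x y : Balaban1983to89.Site P 0) (ν : Fin P.d), |ζ (x.shift ν) y - ζ x y| ≤ K₁ / (R₀ - R₁)) →
      ∀ (x : Balaban1983to89.Site P 0) (μ : Fin P.d),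
        x ∈ (cubeT hPd (P.L ^ k) c fun i => P.L ^ k * M0 i) →
        (∀ i, R₀ + R ≤ (boxCoord hPd (P.L ^ k) c x i : ℝ) ∧ (boxCoord hPd (P.L ^ k) c x i : ℝ) + (R₀ + R) ≤ (P.L ^ k * M0 i : ℕ) - 1) →
        x.shift μ ∈ (cubeT hPd (P.L ^ k) c fun i => P.L ^ k * M0 i) →
        (∀ i, R₀ + R ≤ (boxCoord hPd (P.L ^ k) c (x.shift μ) i : ℝ) ∧
          (boxCoord hPd (P.L ^ k) c (x.shift μ) i : ℝ) + (R₀ + R) ≤ (P.L ^ k * M0 i : ℕ) - 1) →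
      ∀ (f : Balaban1983to89.Site P 0 → ℂ) (F D : ℝ), (∀ y, ‖f y‖ ≤ F) → 0 ≤ D → (∀ y, f y ≠ 0 → D ≤ B5Ineq137Torus.T P 0 x y) →
        ‖covD P.eps⁻¹ (cfg U)
              (gLocT (B1RG242Torus.α P a k * (P.L : ℝ) ^ (k * P.d)) P.eps⁻¹ U k
                (cubeFam hPd (P.L ^ k) c M0 s W) (lamFam hPd (P.L ^ k) c M0 s) ζ *ᵥ f) ⟨x, μ⟩ -
            covD P.eps⁻¹ (cfg U) (gBox (B1RG242Torus.α P a k * (P.L : ℝ) ^ (k * P.d)) P.eps⁻¹ U k Ω *ᵥ f) ⟨x, μ⟩‖ ≤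
          P.spacing k * (C * ((⌊(((P.L : ℝ) ^ k) - 1 + R₀) / s⌋₊ + 3) ^ (d + 1) * (1 + (P.L : ℝ) ^ k * ((R₀ - R₁)⁻¹ + (s : ℝ)⁻¹)) *
              Real.exp (-(δ₀ * (((P.L : ℝ) ^ k)⁻¹ * (2 * R - 1)))) +
            (1 + (P.L : ℝ) ^ k * (R₀ - R₁)⁻¹) * Real.exp (-(δ₀ / 2 * (((P.L : ℝ) ^ k)⁻¹ * (R₁ - 1))))) *
            Real.exp (-(δ₀ / 2 * (((P.L : ℝ) ^ k)⁻¹ * D))) * F) := by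
  set Λ₀ : ℝ := max K₁ (3 * Real.pi * (d + 1 : ℕ) / 2) with hΛ₀def
  have hΛ₀0 : 0 ≤ Λ₀ := hK₁.trans (le_max_left _ _)
  have hΛ₀K : K₁ ≤ Λ₀ := le_max_left _ _
  set C : ℝ := max (2 * c₀) (2 * c₀ * Λ₀ + 1) with hCdef
  have hC3 : 2 * c₀ ≤ C := le_max_left _ _
  have hC1 : c₀ ≤ C := by linarith
  have hC2 : 2 * c₀ * Λ₀ + 1 ≤ C := le_max_right _ _
  have hC4 : c₀ * Λ₀ + 1 ≤ C := by
    have : 0 ≤ c₀ * Λ₀ := mul_nonneg hc₀ hΛ₀0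
    linarith
  have hC0 : 0 ≤ C := hc₀.trans hC1
  refine ⟨C, lt_of_lt_of_le (by linarith [mul_nonneg hc₀ hΛ₀0]) hC2, ?_⟩
  intro P hPd a k _hk1 hkK U Ω δ₀ ρ hδ₀ hρ H1 H2 H3 H4 c M0 hM0 hfit0 hN0 hΩ s W hs R R₀ R₁ hR hR₁ hR10 hW hgap ζ hζabs hζ0 hζR₁ hζ1
    x μ hx hdeep hxe hdeepe f F D hF hD hsupp
  have hn : 1 ≤ P.L ^ k := Nat.one_le_pow _ _ P.L_pos
  have hk : 0 + k ≤ P.m + P.K := by omega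
  have hR1 : 1 < R := by linarith
  have hR0 : 0 ≤ R := by linarith
  have hR₀ : 0 ≤ R₀ := hR₁.trans hR10.le
  have hs0 : 0 < s := hs
  have hsr : (0 : ℝ) < s := by exact_mod_cast hs0
  have hgap' : 0 < R₀ - R₁ := sub_pos.2 hR10
  have hLpos : (0 : ℝ) < P.L := P.cast_L_pos
  have hLk : (0 : ℝ) < (P.L : ℝ) ^ k := pow_pos hLpos _
  have hε : 0 < ((P.L : ℝ) ^ k)⁻¹ := inv_pos.mpr hLk
  have hF0 : 0 ≤ F := (norm_nonneg _).trans (hF x)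
  have hsp0 : 0 < P.spacing k := P.spacing_pos k
  have heps : 0 < P.eps := P.eps_pos
  have hK₁' : 0 ≤ K₁ / (R₀ - R₁) := div_nonneg hK₁ (sub_pos.2 hR10).le
  -- the shallower depth `R₀` (row hypothesis (i), the label multiplicities) at both endpoints
  have hdeep₀ := depth_mono hPd (show R₀ ≤ R₀ + R by linarith) hdeep
  have hdeepe₀ := depth_mono hPd (show R₀ ≤ R₀ + R by linarith) hdeepe
  -- abbreviations
  set Ω₀ : Finset (Balaban1983to89.Site P 0) := cubeT hPd (P.L ^ k) c fun i => P.L ^ k * M0 i with hΩ₀def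
  set A : ℝ := B1RG242Torus.α P a k * (P.L : ℝ) ^ (k * P.d) with hAdef
  set x' := x.shift μ with hx'def
  set G₀ := gBox A P.eps⁻¹ U k Ω with hG₀def
  -- the row `x` inside `Ω`, `ρ`-deep with respect to `T ∖ Ω ⊆ T ∖ Ω₀`
  have hxΩ : x ∈ Ω := hΩ hx
  have hρΩ : ∀ w, w ∉ Ω → ρ ≤ B5Ineq137Torus.T P 0 x w := fun w hw =>
    (lt_T_of_not_mem hPd hfit0 (depth_mono hPd (show ρ ≤ R₀ + R by linarith) hdeep) (fun h => hw (hΩ h))).le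
  set m : ℝ := ((⌊(((P.L : ℝ) ^ k) - 1 + R₀) / s⌋₊ : ℝ) + 3) ^ (d + 1) with hmdef
  have hm0 : 0 ≤ m := by rw [hmdef]; positivity
  set E : ℝ := Real.exp (-(δ₀ / 2 * (((P.L : ℝ) ^ k)⁻¹ * D))) with hEdef
  set E2R : ℝ := Real.exp (-(δ₀ * (((P.L : ℝ) ^ k)⁻¹ * (2 * R - 1)))) with hE2Rdef
  set ER1 : ℝ := Real.exp (-(δ₀ / 2 * (((P.L : ℝ) ^ k)⁻¹ * (R₁ - 1)))) with hER1def
  have hE0 : 0 < E := Real.exp_pos _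
  have hE2R0 : 0 < E2R := Real.exp_pos _
  have hER10 : 0 < ER1 := Real.exp_pos _
  have hεD : 0 ≤ ((P.L : ℝ) ^ k)⁻¹ * D := mul_nonneg hε.le hD
  have hε2R : 0 ≤ ((P.L : ℝ) ^ k)⁻¹ * (2 * R - 1) := mul_nonneg hε.le (by linarith)
  -- exponent bookkeeping: `e^{−δ_iD/L^k} ≤ E`-type facts
  have hED : ∀ {δ'}, δ₀ ≤ δ' → Real.exp (-(δ' * (((P.L : ℝ) ^ k)⁻¹ * D))) ≤ E := by
    intro δ' hδ'
    refine (exp_le_exp_of_rate hδ' hεD).trans (Real.exp_le_exp.2 ?_)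
    have := mul_nonneg hδ₀.le hεD
    linarith
  have hE2 : ∀ {δ'}, δ₀ ≤ δ' → Real.exp (-(δ' * (((P.L : ℝ) ^ k)⁻¹ * (R - 1 + R)))) ≤ E2R := by
    intro δ' hδ'
    rw [show R - 1 + R = 2 * R - 1 by ring]
    exact exp_le_exp_of_rate hδ' hε2R
  set D' : ℝ := max D (R₁ - 1) with hD'def
  have hD'D : D ≤ D' := le_max_left _ _
  have hD'R : R₁ - 1 ≤ D' := le_max_right _ _
  have hD'0 : 0 ≤ D' := hD.trans hD'D
  have hED' : ∀ {δ'}, δ₀ ≤ δ' → Real.exp (-(δ' * (((P.L : ℝ) ^ k)⁻¹ * D'))) ≤ E * ER1 := by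
    intro δ' hδ'
    rw [hEdef, hER1def, ← Real.exp_add]
    refine Real.exp_le_exp.2 ?_
    have hD'0' : 0 ≤ ((P.L : ℝ) ^ k)⁻¹ * D' := mul_nonneg hε.le hD'0
    have h1 : δ₀ * (((P.L : ℝ) ^ k)⁻¹ * D') ≤ δ' * (((P.L : ℝ) ^ k)⁻¹ * D') := mul_le_mul_of_nonneg_right hδ' hD'0'
    have h2 : δ₀ / 2 * (((P.L : ℝ) ^ k)⁻¹ * D) + δ₀ / 2 * (((P.L : ℝ) ^ k)⁻¹ * (R₁ - 1)) ≤ δ₀ * (((P.L : ℝ) ^ k)⁻¹ * D') := by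
      have : D + (R₁ - 1) ≤ 2 * D' := by linarith
      calc δ₀ / 2 * (((P.L : ℝ) ^ k)⁻¹ * D) + δ₀ / 2 * (((P.L : ℝ) ^ k)⁻¹ * (R₁ - 1))
          = δ₀ / 2 * (((P.L : ℝ) ^ k)⁻¹ * (D + (R₁ - 1))) := by ring
        _ ≤ δ₀ / 2 * (((P.L : ℝ) ^ k)⁻¹ * (2 * D')) :=
            mul_le_mul_of_nonneg_left (mul_le_mul_of_nonneg_left this hε.le) (by positivity)
        _ = δ₀ * (((P.L : ℝ) ^ k)⁻¹ * D') := by ring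
    linarith
  -- the sources
  set g' : ↥(labels (P.L ^ k) M0 s) → Balaban1983to89.Site P 0 → ℂ :=
    fun α y => (ζ x' y : ℂ) * (lamFam hPd (P.L ^ k) c M0 s α x' y : ℂ) * f y with hg'def
  set dg : ↥(labels (P.L ^ k) M0 s) → Balaban1983to89.Site P 0 → ℂ :=
    fun α y => ((ζ x' y : ℂ) * (lamFam hPd (P.L ^ k) c M0 s α x' y : ℂ) - (ζ x y : ℂ) * (lamFam hPd (P.L ^ k) c M0 s α x y : ℂ)) * f y
    with hdgdef
  set q' : Balaban1983to89.Site P 0 → ℂ := fun y => ((ζ x' y : ℂ) - 1) * f y with hq'def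
  set dq : Balaban1983to89.Site P 0 → ℂ := fun y => ((ζ x' y : ℂ) - (ζ x y : ℂ)) * f y with hdqdef
  -- the four-term identity (row hypothesis (i) at both endpoints)
  have hid : covD P.eps⁻¹ (cfg U) (gLocT A P.eps⁻¹ U k (cubeFam hPd (P.L ^ k) c M0 s W) (lamFam hPd (P.L ^ k) c M0 s) ζ *ᵥ f) ⟨x, μ⟩ -
      covD P.eps⁻¹ (cfg U) (G₀ *ᵥ f) ⟨x, μ⟩ =
      ∑ α, (covD P.eps⁻¹ (cfg U) (gBox A P.eps⁻¹ U k (cubeFam hPd (P.L ^ k) c M0 s W α) *ᵥ g' α) ⟨x, μ⟩ -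
              covD P.eps⁻¹ (cfg U) (G₀ *ᵥ g' α) ⟨x, μ⟩) +
      ∑ α, ((P.eps⁻¹ : ℝ) : ℂ) * ((gBox A P.eps⁻¹ U k (cubeFam hPd (P.L ^ k) c M0 s W α) *ᵥ dg α) x - (G₀ *ᵥ dg α) x) +
      covD P.eps⁻¹ (cfg U) (G₀ *ᵥ q') ⟨x, μ⟩ + ((P.eps⁻¹ : ℝ) : ℂ) * (G₀ *ᵥ dq) x :=
    covD_gLocT_sub_apply P.eps⁻¹ (cfg U) A P.eps⁻¹ U k (cubeFam hPd (P.L ^ k) c M0 s W) (lamFam hPd (P.L ^ k) c M0 s) ζ G₀ f ⟨x, μ⟩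
      (rowHyp_i hPd hfit0 hζ0 hxe hdeepe₀) (rowHyp_i hPd hfit0 hζ0 hx hdeep₀)
  rw [hid]
  -- the active-label sets of the two endpoints
  set Sx : Finset ↥(labels (P.L ^ k) M0 s) := (activeLabels hPd (P.L ^ k) c s R₀ (blkIter k x)).subtype fun α => α ∈ labels (P.L ^ k) M0 s
    with hSxdef
  set Sx' : Finset ↥(labels (P.L ^ k) M0 s) := (activeLabels hPd (P.L ^ k) c s R₀ (blkIter k x')).subtype fun α => α ∈ labels (P.L ^ k) M0 s
    with hSx'def
  have hcardx : (Sx.card : ℝ) ≤ m := by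
    have h1 := card_subtype_activeLabels_le (hPd := hPd) (c := c) (M0 := M0) hn hs0 hR₀ (blkIter k x)
    have e : (((P.L ^ k : ℕ) : ℕ) : ℝ) = (P.L : ℝ) ^ k := by push_cast; rfl
    rw [hSxdef, hmdef]; rw [e] at h1; exact h1
  have hcardx' : (Sx'.card : ℝ) ≤ m := by
    have h1 := card_subtype_activeLabels_le (hPd := hPd) (c := c) (M0 := M0) hn hs0 hR₀ (blkIter k x')
    have e : (((P.L ^ k : ℕ) : ℕ) : ℝ) = (P.L : ℝ) ^ k := by push_cast; rfl
    rw [hSx'def, hmdef]; rw [e] at h1; exact h1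
  have hSx : ∀ (α : ↥(labels (P.L ^ k) M0 s)) (y : Balaban1983to89.Site P 0),
      ζ x y * lamFam hPd (P.L ^ k) c M0 s α x y ≠ 0 → α ∈ Sx := by
    intro α y hne
    rw [hSxdef, Finset.mem_subtype]
    exact mem_activeLabels_of_ne_zero_of_deep hk hs0 hfit0 hζ0 (mem_blockK.2 rfl) hdeep₀ hne
  have hSx' : ∀ (α : ↥(labels (P.L ^ k) M0 s)) (y : Balaban1983to89.Site P 0),
      ζ x' y * lamFam hPd (P.L ^ k) c M0 s α x' y ≠ 0 → α ∈ Sx' := by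
    intro α y hne
    rw [hSx'def, Finset.mem_subtype]
    exact mem_activeLabels_of_ne_zero_of_deep hk hs0 hfit0 hζ0 (mem_blockK.2 rfl) hdeepe₀ hne
  have hcardU : ((Sx ∪ Sx').card : ℝ) ≤ 2 * m := by
    have h1 : ((Sx ∪ Sx').card : ℝ) ≤ (Sx.card : ℝ) + (Sx'.card : ℝ) := by exact_mod_cast Finset.card_union_le _ _
    linarith
  -- geometry of an active cube READ AGAINST THE WHOLE TORUS: both endpoints and the active sources inside, `T_η ∖ □_α` far
  have hstep : B5Ineq137Torus.T P 0 x' x ≤ 1 := by rw [B5Ineq137Torus.T_symm]; exact T_shift_le_one x μ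
  have hgeo' : ∀ (α : ↥(labels (P.L ^ k) M0 s)) (y₀ : Balaban1983to89.Site P 0), ζ x' y₀ * lamFam hPd (P.L ^ k) c M0 s α x' y₀ ≠ 0 →
      x ∈ cubeFam hPd (P.L ^ k) c M0 s W α ∧ x' ∈ cubeFam hPd (P.L ^ k) c M0 s W α ∧
      (∀ w, w ∉ cubeFam hPd (P.L ^ k) c M0 s W α → R - 1 ≤ B5Ineq137Torus.T P 0 x w) := by
    intro α y₀ hy₀
    obtain ⟨hx'α, -, hfar⟩ := rowHyp_ii_torus hPd hn hs0 hfit0 hR0 hR₀ hgap hW hζ0 hxe hdeepe α y₀ hy₀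
    have hxα : x ∈ cubeFam hPd (P.L ^ k) c M0 s W α := by
      by_contra hnot
      have h1 := (hfar x hnot).1
      linarith
    refine ⟨hxα, hx'α, fun w hnot => ?_⟩
    have h1 := (hfar w hnot).1
    have h2 := abs_le.1 (abs_T_shift_sub_le x w μ)
    linarith
  have hgeo : ∀ (α : ↥(labels (P.L ^ k) M0 s)) (y₀ : Balaban1983to89.Site P 0), ζ x y₀ * lamFam hPd (P.L ^ k) c M0 s α x y₀ ≠ 0 →
      x ∈ cubeFam hPd (P.L ^ k) c M0 s W α ∧
      (∀ w, w ∉ cubeFam hPd (P.L ^ k) c M0 s W α → R - 1 ≤ B5Ineq137Torus.T P 0 x w) := by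
    intro α y₀ hy₀
    obtain ⟨hxα, -, hfar⟩ := rowHyp_ii_torus hPd hn hs0 hfit0 hR0 hR₀ hgap hW hζ0 hx hdeep α y₀ hy₀
    exact ⟨hxα, fun w hnot => by linarith [(hfar w hnot).1]⟩
  -- TERM 1: the (1.11)–(1.12) covariant-derivative closeness input (H1) for the cubes active at `x'`
  set B₁ : ℝ := P.spacing k * (c₀ * Real.exp (-(δ₀ * (((P.L : ℝ) ^ k)⁻¹ * D))) *
    Real.exp (-(δ₀ * (((P.L : ℝ) ^ k)⁻¹ * (R - 1 + R)))) * F) with hB₁def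
  have hB₁0 : 0 ≤ B₁ := by positivity
  have hterm1 : ∀ α, ‖covD P.eps⁻¹ (cfg U) (gBox A P.eps⁻¹ U k (cubeFam hPd (P.L ^ k) c M0 s W α) *ᵥ g' α) ⟨x, μ⟩ -
      covD P.eps⁻¹ (cfg U) (G₀ *ᵥ g' α) ⟨x, μ⟩‖ ≤ B₁ := by
    intro α
    by_cases hex : ∃ y, ζ x' y * lamFam hPd (P.L ^ k) c M0 s α x' y ≠ 0
    · obtain ⟨y₀, hy₀⟩ := hex
      obtain ⟨hxα, hx'α, hfarx⟩ := hgeo' α y₀ hy₀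
      obtain ⟨c', M', hM', hfit', hN', hcα⟩ := cubeFam_fits (hPd := hPd) (n := P.L ^ k) (c := c) (s := s) (W := W) hM0 hfit0 hN0 α
      have hsuppα : ∀ y, y ∉ cubeFam hPd (P.L ^ k) c M0 s W α → g' α y = 0 := by
        intro y hy
        by_contra hne
        exact hy (rowHyp_ii_torus hPd hn hs0 hfit0 hR0 hR₀ hgap hW hζ0 hxe hdeepe α y (rowSource_ne_zero hne).1).2.1
      have hDf : ∀ y, g' α y ≠ 0 → ∀ w, w ∉ cubeFam hPd (P.L ^ k) c M0 s W α → R ≤ B5Ineq137Torus.T P 0 y w :=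
        fun y hy w hw' => ((rowHyp_ii_torus hPd hn hs0 hfit0 hR0 hR₀ hgap hW hζ0 hxe hdeepe α y (rowSource_ne_zero hy).1).2.2 w hw').2
      rw [hcα] at hxα hx'α hfarx hsuppα hDf ⊢
      have hρx : ∀ w, w ∉ (cubeT hPd (P.L ^ k) c' fun i => P.L ^ k * M' i) → ρ ≤ B5Ineq137Torus.T P 0 x w :=
        fun w hw => by linarith [hfarx w hw]
      exact H1 c' M' hM' hfit' hN' (hcα ▸ (cubeOf_subset α.1).trans hΩ) x μ hxα hx'α hρx (g' α) F D (R - 1) R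
        (fun y => norm_rowSource_le (hζabs x' y) (abs_lam_le_one (sum_abs_lamT_le_one hfit0) α x' y) hF y)
        hsuppα hD (fun y hy => hsupp y (rowSource_ne_zero hy).2) (by linarith) hfarx hR0 hDf
    · push Not at hex
      have h0 : g' α = 0 := by
        funext y; rw [hg'def]; dsimp only; rw [← Complex.ofReal_mul, hex y, Complex.ofReal_zero, zero_mul]; rfl
      rw [h0, mulVec_zero, mulVec_zero]
      simp only [covD, Pi.zero_apply, mul_zero, sub_zero, norm_zero]
      exact hB₁0
  have hzero1 : ∀ α, α ∉ Sx' → covD P.eps⁻¹ (cfg U) (gBox A P.eps⁻¹ U k (cubeFam hPd (P.L ^ k) c M0 s W α) *ᵥ g' α) ⟨x, μ⟩ -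
      covD P.eps⁻¹ (cfg U) (G₀ *ᵥ g' α) ⟨x, μ⟩ = 0 := by
    intro α hα
    have h0 : g' α = 0 := by
      funext y
      by_contra hne
      exact hα (hSx' α y (rowSource_ne_zero hne).1)
    rw [h0, mulVec_zero, mulVec_zero]
    simp only [covD, Pi.zero_apply, mul_zero, sub_zero]
  have hsum1 : ‖∑ α, (covD P.eps⁻¹ (cfg U) (gBox A P.eps⁻¹ U k (cubeFam hPd (P.L ^ k) c M0 s W α) *ᵥ g' α) ⟨x, μ⟩ -
      covD P.eps⁻¹ (cfg U) (G₀ *ᵥ g' α) ⟨x, μ⟩)‖ ≤ m * B₁ := by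
    rw [← Finset.sum_subset (Finset.subset_univ Sx') (fun α _ hα => hzero1 α hα)]
    calc ‖∑ α ∈ Sx', (covD P.eps⁻¹ (cfg U) (gBox A P.eps⁻¹ U k (cubeFam hPd (P.L ^ k) c M0 s W α) *ᵥ g' α) ⟨x, μ⟩ -
            covD P.eps⁻¹ (cfg U) (G₀ *ᵥ g' α) ⟨x, μ⟩)‖
        ≤ ∑ α ∈ Sx', ‖covD P.eps⁻¹ (cfg U) (gBox A P.eps⁻¹ U k (cubeFam hPd (P.L ^ k) c M0 s W α) *ᵥ g' α) ⟨x, μ⟩ -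
            covD P.eps⁻¹ (cfg U) (G₀ *ᵥ g' α) ⟨x, μ⟩‖ := norm_sum_le _ _
      _ ≤ ∑ α ∈ Sx', B₁ := Finset.sum_le_sum fun α _ => hterm1 α
      _ = Sx'.card * B₁ := by rw [Finset.sum_const, nsmul_eq_mul]
      _ ≤ m * B₁ := mul_le_mul_of_nonneg_right hcardx' hB₁0
  -- TERM 2: the (1.11)–(1.12) value closeness input (H2) on the difference sources, cubes active at `x` or `x'`
  set Λ : ℝ := K₁ / (R₀ - R₁) + 3 * Real.pi * (d + 1 : ℕ) / (2 * s) with hΛdef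
  have hΛ0 : 0 ≤ Λ := by rw [hΛdef]; positivity
  set B₂ : ℝ := P.spacing k ^ 2 * (c₀ * Real.exp (-(δ₀ * (((P.L : ℝ) ^ k)⁻¹ * D))) *
    Real.exp (-(δ₀ * (((P.L : ℝ) ^ k)⁻¹ * (R - 1 + R)))) * (Λ * F)) with hB₂def
  have hB₂0 : 0 ≤ B₂ := by positivity
  have hterm2 : ∀ α, ‖(gBox A P.eps⁻¹ U k (cubeFam hPd (P.L ^ k) c M0 s W α) *ᵥ dg α) x - (G₀ *ᵥ dg α) x‖ ≤ B₂ := by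
    intro α
    by_cases hex : ∃ y, dg α y ≠ 0
    · obtain ⟨y₀, hy₀⟩ := hex
      -- an active pair at one endpoint: `x` is in the cube and `T_η ∖ □_α` is `≥ R − 1` away from `x`
      have hact : ∀ y, dg α y ≠ 0 → ζ x' y * lamFam hPd (P.L ^ k) c M0 s α x' y ≠ 0 ∨ ζ x y * lamFam hPd (P.L ^ k) c M0 s α x y ≠ 0 := by
        intro y hy
        by_contra hno
        rw [not_or, not_not, not_not] at hno
        apply hy
        rw [hdgdef]; dsimp only
        rw [← Complex.ofReal_mul, ← Complex.ofReal_mul, hno.1, hno.2]; simp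
      have hxfar : x ∈ cubeFam hPd (P.L ^ k) c M0 s W α ∧
          ∀ w, w ∉ cubeFam hPd (P.L ^ k) c M0 s W α → R - 1 ≤ B5Ineq137Torus.T P 0 x w := by
        rcases hact y₀ hy₀ with h1 | h1
        · exact ⟨(hgeo' α y₀ h1).1, (hgeo' α y₀ h1).2.2⟩
        · exact hgeo α y₀ h1
      obtain ⟨hxα, hfarx⟩ := hxfar
      obtain ⟨c', M', hM', hfit', hN', hcα⟩ := cubeFam_fits (hPd := hPd) (n := P.L ^ k) (c := c) (s := s) (W := W) hM0 hfit0 hN0 α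
      have hsuppα : ∀ y, y ∉ cubeFam hPd (P.L ^ k) c M0 s W α → dg α y = 0 := by
        intro y hy
        by_contra hne
        rcases hact y hne with h1 | h1
        · exact hy (rowHyp_ii_torus hPd hn hs0 hfit0 hR0 hR₀ hgap hW hζ0 hxe hdeepe α y h1).2.1
        · exact hy (rowHyp_ii_torus hPd hn hs0 hfit0 hR0 hR₀ hgap hW hζ0 hx hdeep α y h1).2.1
      have hDf : ∀ y, dg α y ≠ 0 → ∀ w, w ∉ cubeFam hPd (P.L ^ k) c M0 s W α → R ≤ B5Ineq137Torus.T P 0 y w := by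
        intro y hy w hw'
        rcases hact y hy with h1 | h1
        · exact ((rowHyp_ii_torus hPd hn hs0 hfit0 hR0 hR₀ hgap hW hζ0 hxe hdeepe α y h1).2.2 w hw').2
        · exact ((rowHyp_ii_torus hPd hn hs0 hfit0 hR0 hR₀ hgap hW hζ0 hx hdeep α y h1).2.2 w hw').2
      rw [hcα] at hxα hfarx hsuppα hDf ⊢
      have hρx : ∀ w, w ∉ (cubeT hPd (P.L ^ k) c' fun i => P.L ^ k * M' i) → ρ ≤ B5Ineq137Torus.T P 0 x w :=
        fun w hw => by linarith [hfarx w hw]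
      exact H2 c' M' hM' hfit' hN' (hcα ▸ (cubeOf_subset α.1).trans hΩ) x hxα hρx (dg α) (Λ * F) D (R - 1) R
        (fun y => norm_rowSource_sub_le_of_lipschitz hPd hs0 hfit0 hN0 hK₁' hζabs (fun y => hζ1 x y μ) α.1 hx hxe hF y)
        hsuppα hD (fun y hy => hsupp y (right_ne_zero_of_mul hy)) (by linarith) hfarx hR0 hDf
    · push Not at hex
      have h0 : dg α = 0 := funext hex
      rw [h0, mulVec_zero, mulVec_zero, Pi.zero_apply, sub_zero, norm_zero]
      exact hB₂0
  have hzero2 : ∀ α, α ∉ Sx ∪ Sx' → (gBox A P.eps⁻¹ U k (cubeFam hPd (P.L ^ k) c M0 s W α) *ᵥ dg α) x - (G₀ *ᵥ dg α) x = 0 := by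
    intro α hα
    rw [Finset.mem_union, not_or] at hα
    have h0 : dg α = 0 := by
      funext y
      rw [hdgdef]; dsimp only
      have h1 : ζ x' y * lamFam hPd (P.L ^ k) c M0 s α x' y = 0 := by
        by_contra hne; exact hα.2 (hSx' α y hne)
      have h2 : ζ x y * lamFam hPd (P.L ^ k) c M0 s α x y = 0 := by
        by_contra hne; exact hα.1 (hSx α y hne)
      rw [← Complex.ofReal_mul, ← Complex.ofReal_mul, h1, h2]; simp
    rw [h0, mulVec_zero, mulVec_zero, Pi.zero_apply, sub_zero]
  have hsum2 : ‖∑ α, ((P.eps⁻¹ : ℝ) : ℂ) * ((gBox A P.eps⁻¹ U k (cubeFam hPd (P.L ^ k) c M0 s W α) *ᵥ dg α) x - (G₀ *ᵥ dg α) x)‖ ≤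
      P.eps⁻¹ * (2 * m * B₂) := by
    rw [← Finset.mul_sum, norm_mul, Complex.norm_real, Real.norm_eq_abs, abs_of_pos (inv_pos.mpr heps)]
    refine mul_le_mul_of_nonneg_left ?_ (inv_pos.mpr heps).le
    rw [← Finset.sum_subset (Finset.subset_univ (Sx ∪ Sx')) (fun α _ hα => hzero2 α hα)]
    calc ‖∑ α ∈ Sx ∪ Sx', ((gBox A P.eps⁻¹ U k (cubeFam hPd (P.L ^ k) c M0 s W α) *ᵥ dg α) x - (G₀ *ᵥ dg α) x)‖
        ≤ ∑ α ∈ Sx ∪ Sx', ‖(gBox A P.eps⁻¹ U k (cubeFam hPd (P.L ^ k) c M0 s W α) *ᵥ dg α) x - (G₀ *ᵥ dg α) x‖ := norm_sum_le _ _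
      _ ≤ ∑ α ∈ Sx ∪ Sx', B₂ := Finset.sum_le_sum fun α _ => hterm2 α
      _ = (Sx ∪ Sx').card * B₂ := by rw [Finset.sum_const, nsmul_eq_mul]
      _ ≤ 2 * m * B₂ := mul_le_mul_of_nonneg_right hcardU hB₂0
  -- TERM 3: the (1.10) covariant-derivative input (H3) for `G_k(T_η,u)` on the tail `q'`
  set B₃ : ℝ := P.spacing k * (c₀ * Real.exp (-(δ₀ * (((P.L : ℝ) ^ k)⁻¹ * D'))) * (2 * F)) with hB₃def
  have hterm3 : ‖covD P.eps⁻¹ (cfg U) (G₀ *ᵥ q') ⟨x, μ⟩‖ ≤ B₃ := by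
    have hsq : ∀ y, q' y ≠ 0 → D' ≤ B5Ineq137Torus.T P 0 x y := fun y hy => by
      obtain ⟨hf, hT⟩ := T_gt_of_tail_ne_zero' hζR₁ x μ hy
      exact max_le (hsupp y hf) hT.le
    exact H3 x hxΩ hρΩ μ q' (2 * F) D' (fun y => norm_tail_le' hζabs x' hF y) hD'0 hsq
  -- TERM 4: the (1.10) value input (H4) for `G_k(T_η,u)` on the tail difference `dq`
  set B₄ : ℝ := P.spacing k ^ 2 * (c₀ * Real.exp (-(δ₀ * (((P.L : ℝ) ^ k)⁻¹ * D'))) * (K₁ / (R₀ - R₁) * F)) with hB₄def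
  have hterm4 : ‖((P.eps⁻¹ : ℝ) : ℂ) * (G₀ *ᵥ dq) x‖ ≤ P.eps⁻¹ * B₄ := by
    rw [norm_mul, Complex.norm_real, Real.norm_eq_abs, abs_of_pos (inv_pos.mpr heps)]
    refine mul_le_mul_of_nonneg_left ?_ (inv_pos.mpr heps).le
    have hsq : ∀ y, dq y ≠ 0 → D' ≤ B5Ineq137Torus.T P 0 x y := fun y hy => by
      obtain ⟨hf, hT⟩ := T_gt_of_tailDiff_ne_zero' hζR₁ x μ hy
      exact max_le (hsupp y hf) hT.le
    exact H4 x hxΩ hρΩ dq (K₁ / (R₀ - R₁) * F) D' (fun y => norm_tailDiff_le' hK₁' (fun y => hζ1 x y μ) hF y)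
      hD'0 hsq
  -- assembling (verbatim from gen 27's `deriv231_flat_cwt` / r18's `deriv231_wholeTorus_flat_cwt`)
  have hscale : P.eps⁻¹ * P.spacing k ^ 2 = P.spacing k * (P.L : ℝ) ^ k := by
    rw [Params.spacing]
    field_simp
  have hΛle : Λ ≤ Λ₀ * ((R₀ - R₁)⁻¹ + (s : ℝ)⁻¹) := by
    rw [hΛdef, mul_add]
    refine add_le_add ?_ ?_
    · rw [div_eq_mul_inv]
      exact mul_le_mul_of_nonneg_right (le_max_left _ _) (inv_pos.mpr hgap').le
    · have e : 3 * Real.pi * (d + 1 : ℕ) / (2 * s) = (3 * Real.pi * (d + 1 : ℕ) / 2) * (s : ℝ)⁻¹ := by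
        field_simp
      rw [e]
      exact mul_le_mul_of_nonneg_right (le_max_right _ _) (inv_pos.mpr hsr).le
  have hKle : K₁ / (R₀ - R₁) ≤ Λ₀ * (R₀ - R₁)⁻¹ := by
    rw [div_eq_mul_inv]; exact mul_le_mul_of_nonneg_right hΛ₀K (inv_pos.mpr hgap').le
  -- term 1 ≤ spacing·(C·m·E2R·E·F)
  have h1 : m * B₁ ≤ P.spacing k * (C * (m * 1 * E2R) * E * F) := by
    have : B₁ ≤ P.spacing k * (C * E2R * E * F) := by
      rw [hB₁def]
      refine mul_le_mul_of_nonneg_left ?_ hsp0.le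
      have := mul_le_mul (mul_le_mul hC1 (hED le_rfl) (Real.exp_pos _).le hC0) (hE2 le_rfl) (Real.exp_pos _).le (by positivity)
      calc c₀ * Real.exp (-(δ₀ * (((P.L : ℝ) ^ k)⁻¹ * D))) * Real.exp (-(δ₀ * (((P.L : ℝ) ^ k)⁻¹ * (R - 1 + R)))) * F
          ≤ C * E * E2R * F := mul_le_mul_of_nonneg_right this hF0
        _ = C * E2R * E * F := by ring
    calc m * B₁ ≤ m * (P.spacing k * (C * E2R * E * F)) := mul_le_mul_of_nonneg_left this hm0
      _ = P.spacing k * (C * (m * 1 * E2R) * E * F) := by ring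
  -- term 2 ≤ spacing·(C·m·L^k((R₀−R₁)⁻¹ + s⁻¹)·E2R·E·F)
  have h2 : P.eps⁻¹ * (2 * m * B₂) ≤ P.spacing k * (C * (m * ((P.L : ℝ) ^ k * ((R₀ - R₁)⁻¹ + (s : ℝ)⁻¹)) * E2R) * E * F) := by
    have e : P.eps⁻¹ * (2 * m * B₂) = P.spacing k * ((2 * c₀ * Λ) * m * (P.L : ℝ) ^ k *
        (Real.exp (-(δ₀ * (((P.L : ℝ) ^ k)⁻¹ * D))) * Real.exp (-(δ₀ * (((P.L : ℝ) ^ k)⁻¹ * (R - 1 + R))))) * F) := by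
      rw [hB₂def]
      have : P.eps⁻¹ * (2 * m * (P.spacing k ^ 2 * (c₀ * Real.exp (-(δ₀ * (((P.L : ℝ) ^ k)⁻¹ * D))) *
          Real.exp (-(δ₀ * (((P.L : ℝ) ^ k)⁻¹ * (R - 1 + R)))) * (Λ * F)))) =
          (P.eps⁻¹ * P.spacing k ^ 2) * (2 * c₀ * Λ * m *
            (Real.exp (-(δ₀ * (((P.L : ℝ) ^ k)⁻¹ * D))) * Real.exp (-(δ₀ * (((P.L : ℝ) ^ k)⁻¹ * (R - 1 + R))))) * F) := by ring
      rw [this, hscale]; ring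
    rw [e]
    refine mul_le_mul_of_nonneg_left ?_ hsp0.le
    have hcoef : 2 * c₀ * Λ * m * (P.L : ℝ) ^ k ≤ C * (m * ((P.L : ℝ) ^ k * ((R₀ - R₁)⁻¹ + (s : ℝ)⁻¹))) := by
      have h3 : 2 * c₀ * Λ ≤ C * ((R₀ - R₁)⁻¹ + (s : ℝ)⁻¹) := by
        calc 2 * c₀ * Λ ≤ 2 * c₀ * (Λ₀ * ((R₀ - R₁)⁻¹ + (s : ℝ)⁻¹)) := mul_le_mul_of_nonneg_left hΛle (by positivity)
          _ = (2 * c₀ * Λ₀) * ((R₀ - R₁)⁻¹ + (s : ℝ)⁻¹) := by ring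
          _ ≤ C * ((R₀ - R₁)⁻¹ + (s : ℝ)⁻¹) := mul_le_mul_of_nonneg_right (by linarith) (by positivity)
      calc 2 * c₀ * Λ * m * (P.L : ℝ) ^ k = (2 * c₀ * Λ) * (m * (P.L : ℝ) ^ k) := by ring
        _ ≤ (C * ((R₀ - R₁)⁻¹ + (s : ℝ)⁻¹)) * (m * (P.L : ℝ) ^ k) := mul_le_mul_of_nonneg_right h3 (by positivity)
        _ = C * (m * ((P.L : ℝ) ^ k * ((R₀ - R₁)⁻¹ + (s : ℝ)⁻¹))) := by ring
    have hexp : Real.exp (-(δ₀ * (((P.L : ℝ) ^ k)⁻¹ * D))) * Real.exp (-(δ₀ * (((P.L : ℝ) ^ k)⁻¹ * (R - 1 + R)))) ≤ E2R * E := by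
      calc _ ≤ E * E2R := mul_le_mul (hED le_rfl) (hE2 le_rfl) (Real.exp_pos _).le hE0.le
        _ = E2R * E := mul_comm _ _
    calc 2 * c₀ * Λ * m * (P.L : ℝ) ^ k *
          (Real.exp (-(δ₀ * (((P.L : ℝ) ^ k)⁻¹ * D))) * Real.exp (-(δ₀ * (((P.L : ℝ) ^ k)⁻¹ * (R - 1 + R))))) * F
        ≤ C * (m * ((P.L : ℝ) ^ k * ((R₀ - R₁)⁻¹ + (s : ℝ)⁻¹))) * (E2R * E) * F :=
          mul_le_mul_of_nonneg_right (mul_le_mul hcoef hexp (by positivity) (by positivity)) hF0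
      _ = C * (m * ((P.L : ℝ) ^ k * ((R₀ - R₁)⁻¹ + (s : ℝ)⁻¹)) * E2R) * E * F := by ring
  -- term 3 ≤ spacing·(C·1·ER1·E·F)
  have h3 : B₃ ≤ P.spacing k * (C * (1 * ER1) * E * F) := by
    rw [hB₃def]
    refine mul_le_mul_of_nonneg_left ?_ hsp0.le
    calc c₀ * Real.exp (-(δ₀ * (((P.L : ℝ) ^ k)⁻¹ * D'))) * (2 * F) = (2 * c₀) * Real.exp (-(δ₀ * (((P.L : ℝ) ^ k)⁻¹ * D'))) * F := by
          ring
      _ ≤ C * (E * ER1) * F := mul_le_mul_of_nonneg_right (mul_le_mul hC3 (hED' le_rfl) (Real.exp_pos _).le hC0) hF0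
      _ = C * (1 * ER1) * E * F := by ring
  -- term 4 ≤ spacing·(C·L^k(R₀−R₁)⁻¹·ER1·E·F)
  have h4 : P.eps⁻¹ * B₄ ≤ P.spacing k * (C * ((P.L : ℝ) ^ k * (R₀ - R₁)⁻¹ * ER1) * E * F) := by
    have e : P.eps⁻¹ * B₄ = P.spacing k * ((c₀ * (K₁ / (R₀ - R₁))) * (P.L : ℝ) ^ k * Real.exp (-(δ₀ * (((P.L : ℝ) ^ k)⁻¹ * D'))) * F) := by
      rw [hB₄def]
      have : P.eps⁻¹ * (P.spacing k ^ 2 * (c₀ * Real.exp (-(δ₀ * (((P.L : ℝ) ^ k)⁻¹ * D'))) * (K₁ / (R₀ - R₁) * F))) =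
          (P.eps⁻¹ * P.spacing k ^ 2) * (c₀ * (K₁ / (R₀ - R₁)) * Real.exp (-(δ₀ * (((P.L : ℝ) ^ k)⁻¹ * D'))) * F) := by ring
      rw [this, hscale]; ring
    rw [e]
    refine mul_le_mul_of_nonneg_left ?_ hsp0.le
    have hcoef : c₀ * (K₁ / (R₀ - R₁)) * (P.L : ℝ) ^ k ≤ C * ((P.L : ℝ) ^ k * (R₀ - R₁)⁻¹) := by
      have h5 : c₀ * (K₁ / (R₀ - R₁)) ≤ C * (R₀ - R₁)⁻¹ := by
        calc c₀ * (K₁ / (R₀ - R₁)) ≤ c₀ * (Λ₀ * (R₀ - R₁)⁻¹) := mul_le_mul_of_nonneg_left hKle hc₀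
          _ = (c₀ * Λ₀) * (R₀ - R₁)⁻¹ := by ring
          _ ≤ C * (R₀ - R₁)⁻¹ := mul_le_mul_of_nonneg_right (by linarith) (inv_pos.mpr hgap').le
      calc c₀ * (K₁ / (R₀ - R₁)) * (P.L : ℝ) ^ k ≤ C * (R₀ - R₁)⁻¹ * (P.L : ℝ) ^ k := mul_le_mul_of_nonneg_right h5 hLk.le
        _ = C * ((P.L : ℝ) ^ k * (R₀ - R₁)⁻¹) := by ring
    calc c₀ * (K₁ / (R₀ - R₁)) * (P.L : ℝ) ^ k * Real.exp (-(δ₀ * (((P.L : ℝ) ^ k)⁻¹ * D'))) * F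
        ≤ C * ((P.L : ℝ) ^ k * (R₀ - R₁)⁻¹) * (E * ER1) * F :=
          mul_le_mul_of_nonneg_right (mul_le_mul hcoef (hED' le_rfl) (Real.exp_pos _).le (by positivity)) hF0
      _ = C * ((P.L : ℝ) ^ k * (R₀ - R₁)⁻¹ * ER1) * E * F := by ring
  refine ((norm_add_le _ _).trans (add_le_add ((norm_add_le _ _).trans (add_le_add ((norm_add_le _ _).trans
    (add_le_add hsum1 hsum2)) hterm3)) hterm4)).trans ?_
  calc m * B₁ + P.eps⁻¹ * (2 * m * B₂) + B₃ + P.eps⁻¹ * B₄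
      ≤ P.spacing k * (C * (m * 1 * E2R) * E * F) + P.spacing k * (C * (m * ((P.L : ℝ) ^ k * ((R₀ - R₁)⁻¹ + (s : ℝ)⁻¹)) * E2R) * E * F) +
        P.spacing k * (C * (1 * ER1) * E * F) + P.spacing k * (C * ((P.L : ℝ) ^ k * (R₀ - R₁)⁻¹ * ER1) * E * F) :=
        add_le_add (add_le_add (add_le_add h1 h2) h3) h4
    _ = P.spacing k * (C * (m * (1 + (P.L : ℝ) ^ k * ((R₀ - R₁)⁻¹ + (s : ℝ)⁻¹)) * E2R + (1 + (P.L : ℝ) ^ k * (R₀ - R₁)⁻¹) * ER1) * E * F) := by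
        ring


/-! ## §2 The member for the smooth product cut-off `ζ″ = ζ^Π(R₁, R₀)` of (2.29) -/

section ZetaPiMember

open BIJ88LocDeriv230ZetaPiFlatTorus (zetaPi_zero_eq_zero_of_le zetaPi_zero_eq_one_of_le abs_zetaPi_zero_le_one abs_zetaPi_zero_shift_sub_le)
open BIJ88HkLocHolderTorus (zetaPi)
open Literature.Analysis.Calculus (exists_abs_deriv_and_deriv_deriv_smoothTransition_le)

set_option maxHeartbeats 400000 in
/-- **THE COVARIANT-DERIVATIVE ANALOGUE OF (2.31) FOR A GENERAL REGION `Ω ⊇ Ω₀` AT r18's SMOOTH PRODUCT CUT-OFF `ζ″ = ζ^Π(R₁, R₀)` OF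
(2.29), FROM THE FOUR [6]-INPUTS AS HYPOTHESES** (print p. 263: *"ζ_k(x₁, x₂) is a smooth function of x₁ − x₂"*, (2.29), (2.31)): §1 with
`ζ″ := zetaPi R₁ R₀ 0` — hypothesis-free in the cut-off (`|ζ^Π| ≤ 1`, `= 0` beyond `R₀`, `= 1` within `R₁`, one-step modulus `C_σ/(R₀ − R₁)`
from the universal profile bound `C_σ` of `Literature.Analysis.Calculus.exists_abs_deriv_and_deriv_deriv_smoothTransition_le`); the constant
`C` depends on `(d, c₀)` and `C_σ` only.
[cite: BalabanImbrieJaffe1988, (2.29), (2.31) p.263] [cite: Balaban1983RegularityDecay, Theorem p.573 (1.10)–(1.12)] -/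
theorem deriv231_region_of_inputs_zetaPi (d : ℕ) {c₀ : ℝ} (hc₀ : 0 ≤ c₀) :
    ∃ C : ℝ, 0 < C ∧ ∀ (P : Params) (hPd : P.d = d + 1) (a : ℝ) (k : ℕ), 1 ≤ k → k ≤ P.K →
      ∀ (U : GaugeField P 0 U1) (Ω : Finset (Balaban1983to89.Site P 0)) (δ₀ ρ : ℝ), 0 < δ₀ → 0 ≤ ρ →
      -- (H1) the (1.11)–(1.12) covariant-derivative closeness member for the fitting no-wrap cubes `□ ⊆ Ω`
      (∀ (c' M' : Fin (d + 1) → ℕ), (∀ i, 1 ≤ M' i) → (∀ i, c' i * P.L ^ k + P.L ^ k * M' i ≤ P.sitesPerDir 0) →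
          (∀ i, P.L ^ k * M' i < P.sitesPerDir 0) → (cubeT hPd (P.L ^ k) c' fun i => P.L ^ k * M' i) ⊆ Ω →
        ∀ (x : Balaban1983to89.Site P 0) (μ : Fin P.d), x ∈ (cubeT hPd (P.L ^ k) c' fun i => P.L ^ k * M' i) →
          x.shift μ ∈ (cubeT hPd (P.L ^ k) c' fun i => P.L ^ k * M' i) →
          (∀ w, w ∉ (cubeT hPd (P.L ^ k) c' fun i => P.L ^ k * M' i) → ρ ≤ B5Ineq137Torus.T P 0 x w) →
        ∀ (g : Balaban1983to89.Site P 0 → ℂ) (F D Db Df : ℝ), (∀ y, ‖g y‖ ≤ F) →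
          (∀ y, y ∉ (cubeT hPd (P.L ^ k) c' fun i => P.L ^ k * M' i) → g y = 0) →
          0 ≤ D → (∀ y, g y ≠ 0 → D ≤ B5Ineq137Torus.T P 0 x y) →
          0 ≤ Db → (∀ w, w ∉ (cubeT hPd (P.L ^ k) c' fun i => P.L ^ k * M' i) → Db ≤ B5Ineq137Torus.T P 0 x w) →
          0 ≤ Df → (∀ y, g y ≠ 0 → ∀ w, w ∉ (cubeT hPd (P.L ^ k) c' fun i => P.L ^ k * M' i) → Df ≤ B5Ineq137Torus.T P 0 y w) →
          ‖covD P.eps⁻¹ (cfg U) (gBox (B1RG242Torus.α P a k * (P.L : ℝ) ^ (k * P.d)) P.eps⁻¹ U k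
                  (cubeT hPd (P.L ^ k) c' fun i => P.L ^ k * M' i) *ᵥ g) ⟨x, μ⟩ -
              covD P.eps⁻¹ (cfg U) (gBox (B1RG242Torus.α P a k * (P.L : ℝ) ^ (k * P.d)) P.eps⁻¹ U k Ω *ᵥ g) ⟨x, μ⟩‖ ≤
            P.spacing k * (c₀ * Real.exp (-(δ₀ * (((P.L : ℝ) ^ k)⁻¹ * D))) * Real.exp (-(δ₀ * (((P.L : ℝ) ^ k)⁻¹ * (Db + Df)))) * F)) →
      -- (H2) the (1.11)–(1.12) value closeness member for the same cubes and rows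
      (∀ (c' M' : Fin (d + 1) → ℕ), (∀ i, 1 ≤ M' i) → (∀ i, c' i * P.L ^ k + P.L ^ k * M' i ≤ P.sitesPerDir 0) →
          (∀ i, P.L ^ k * M' i < P.sitesPerDir 0) → (cubeT hPd (P.L ^ k) c' fun i => P.L ^ k * M' i) ⊆ Ω →
        ∀ (x : Balaban1983to89.Site P 0), x ∈ (cubeT hPd (P.L ^ k) c' fun i => P.L ^ k * M' i) →
          (∀ w, w ∉ (cubeT hPd (P.L ^ k) c' fun i => P.L ^ k * M' i) → ρ ≤ B5Ineq137Torus.T P 0 x w) →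
        ∀ (g : Balaban1983to89.Site P 0 → ℂ) (F D Db Df : ℝ), (∀ y, ‖g y‖ ≤ F) →
          (∀ y, y ∉ (cubeT hPd (P.L ^ k) c' fun i => P.L ^ k * M' i) → g y = 0) →
          0 ≤ D → (∀ y, g y ≠ 0 → D ≤ B5Ineq137Torus.T P 0 x y) →
          0 ≤ Db → (∀ w, w ∉ (cubeT hPd (P.L ^ k) c' fun i => P.L ^ k * M' i) → Db ≤ B5Ineq137Torus.T P 0 x w) →
          0 ≤ Df → (∀ y, g y ≠ 0 → ∀ w, w ∉ (cubeT hPd (P.L ^ k) c' fun i => P.L ^ k * M' i) → Df ≤ B5Ineq137Torus.T P 0 y w) →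
          ‖(gBox (B1RG242Torus.α P a k * (P.L : ℝ) ^ (k * P.d)) P.eps⁻¹ U k (cubeT hPd (P.L ^ k) c' fun i => P.L ^ k * M' i) *ᵥ g) x -
              (gBox (B1RG242Torus.α P a k * (P.L : ℝ) ^ (k * P.d)) P.eps⁻¹ U k Ω *ᵥ g) x‖ ≤
            P.spacing k ^ 2 * (c₀ * Real.exp (-(δ₀ * (((P.L : ℝ) ^ k)⁻¹ * D))) * Real.exp (-(δ₀ * (((P.L : ℝ) ^ k)⁻¹ * (Db + Df)))) * F)) →
      -- (H3) the (1.10) covariant-derivative member of `G_k(Ω,u)` at the `ρ`-deep rows of `Ω`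
      (∀ (x : Balaban1983to89.Site P 0), x ∈ Ω → (∀ w, w ∉ Ω → ρ ≤ B5Ineq137Torus.T P 0 x w) →
        ∀ (μ : Fin P.d) (g : Balaban1983to89.Site P 0 → ℂ) (F D : ℝ), (∀ y, ‖g y‖ ≤ F) → 0 ≤ D →
          (∀ y, g y ≠ 0 → D ≤ B5Ineq137Torus.T P 0 x y) →
          ‖covD P.eps⁻¹ (cfg U) (gBox (B1RG242Torus.α P a k * (P.L : ℝ) ^ (k * P.d)) P.eps⁻¹ U k Ω *ᵥ g) ⟨x, μ⟩‖ ≤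
            P.spacing k * (c₀ * Real.exp (-(δ₀ * (((P.L : ℝ) ^ k)⁻¹ * D))) * F)) →
      -- (H4) the (1.10) value member of `G_k(Ω,u)` at the `ρ`-deep rows of `Ω`
      (∀ (x : Balaban1983to89.Site P 0), x ∈ Ω → (∀ w, w ∉ Ω → ρ ≤ B5Ineq137Torus.T P 0 x w) →
        ∀ (g : Balaban1983to89.Site P 0 → ℂ) (F D : ℝ), (∀ y, ‖g y‖ ≤ F) → 0 ≤ D →
          (∀ y, g y ≠ 0 → D ≤ B5Ineq137Torus.T P 0 x y) →
          ‖(gBox (B1RG242Torus.α P a k * (P.L : ℝ) ^ (k * P.d)) P.eps⁻¹ U k Ω *ᵥ g) x‖ ≤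
            P.spacing k ^ 2 * (c₀ * Real.exp (-(δ₀ * (((P.L : ℝ) ^ k)⁻¹ * D))) * F)) →
      ∀ (c M0 : Fin (d + 1) → ℕ), (∀ i, 1 ≤ M0 i) →
        (∀ i, c i * P.L ^ k + P.L ^ k * M0 i ≤ P.sitesPerDir 0) → (∀ i, P.L ^ k * M0 i < P.sitesPerDir 0) →
        (cubeT hPd (P.L ^ k) c fun i => P.L ^ k * M0 i) ⊆ Ω →
      ∀ (s W : ℕ), 1 ≤ s → ∀ (R R₀ R₁ : ℝ), ρ + 1 < R → 0 ≤ R₁ → R₁ < R₀ → 2 * (s : ℝ) / 3 + R₀ / 2 + R ≤ W →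
        (∀ i, ((P.L ^ k * M0 i : ℕ) : ℝ) + R ≤ P.sitesPerDir 0) →
      ∀ (x : Balaban1983to89.Site P 0) (μ : Fin P.d),
        x ∈ (cubeT hPd (P.L ^ k) c fun i => P.L ^ k * M0 i) →
        (∀ i, R₀ + R ≤ (boxCoord hPd (P.L ^ k) c x i : ℝ) ∧ (boxCoord hPd (P.L ^ k) c x i : ℝ) + (R₀ + R) ≤ (P.L ^ k * M0 i : ℕ) - 1) →
        x.shift μ ∈ (cubeT hPd (P.L ^ k) c fun i => P.L ^ k * M0 i) →
        (∀ i, R₀ + R ≤ (boxCoord hPd (P.L ^ k) c (x.shift μ) i : ℝ) ∧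
          (boxCoord hPd (P.L ^ k) c (x.shift μ) i : ℝ) + (R₀ + R) ≤ (P.L ^ k * M0 i : ℕ) - 1) →
      ∀ (f : Balaban1983to89.Site P 0 → ℂ) (F D : ℝ), (∀ y, ‖f y‖ ≤ F) → 0 ≤ D → (∀ y, f y ≠ 0 → D ≤ B5Ineq137Torus.T P 0 x y) →
        ‖covD P.eps⁻¹ (cfg U)
              (gLocT (B1RG242Torus.α P a k * (P.L : ℝ) ^ (k * P.d)) P.eps⁻¹ U k
                (cubeFam hPd (P.L ^ k) c M0 s W) (lamFam hPd (P.L ^ k) c M0 s) (zetaPi R₁ R₀ 0) *ᵥ f) ⟨x, μ⟩ -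
            covD P.eps⁻¹ (cfg U) (gBox (B1RG242Torus.α P a k * (P.L : ℝ) ^ (k * P.d)) P.eps⁻¹ U k Ω *ᵥ f) ⟨x, μ⟩‖ ≤
          P.spacing k * (C * ((⌊(((P.L : ℝ) ^ k) - 1 + R₀) / s⌋₊ + 3) ^ (d + 1) * (1 + (P.L : ℝ) ^ k * ((R₀ - R₁)⁻¹ + (s : ℝ)⁻¹)) *
              Real.exp (-(δ₀ * (((P.L : ℝ) ^ k)⁻¹ * (2 * R - 1)))) +
            (1 + (P.L : ℝ) ^ k * (R₀ - R₁)⁻¹) * Real.exp (-(δ₀ / 2 * (((P.L : ℝ) ^ k)⁻¹ * (R₁ - 1))))) *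
            Real.exp (-(δ₀ / 2 * (((P.L : ℝ) ^ k)⁻¹ * D))) * F) := by
  obtain ⟨Cσ, hCσ0, hCσ1, -⟩ := exists_abs_deriv_and_deriv_deriv_smoothTransition_le
  obtain ⟨C, hC0, H⟩ := deriv231_region_of_inputs_of_lipschitz d hc₀ hCσ0
  refine ⟨C, hC0, ?_⟩
  intro P hPd a k hk1 hkK U Ω δ₀ ρ hδ₀ hρ H1 H2 H3 H4 c M0 hM0 hfit0 hN0 hΩ s W hs R R₀ R₁ hR hR₁ hR10 hW hgap
    x μ hx hdeep hxe hdeepe f F D hF hD hsupp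
  exact H P hPd a k hk1 hkK U Ω δ₀ ρ hδ₀ hρ H1 H2 H3 H4 c M0 hM0 hfit0 hN0 hΩ s W hs R R₀ R₁ hR hR₁ hR10 hW hgap (zetaPi R₁ R₀ 0)
    (abs_zetaPi_zero_le_one R₁ R₀) (zetaPi_zero_eq_zero_of_le hR10) (zetaPi_zero_eq_one_of_le hR10) (abs_zetaPi_zero_shift_sub_le hCσ1 hR10)
    x μ hx hdeep hxe hdeepe f F D hF hD hsupp

end ZetaPiMember

end

end Literature.MathematicalPhysics.QuantumFieldTheory.BalabanImbrieJaffe1984to88.BIJ88LocDeriv231RegionOfInputsLipschitz
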